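/-
Copyright (c) 2026. All rights reserved.
Released under Apache 2.0 license as described in the file LICENSE.
Authors: HodgeCM publication cell (pub-hodgecm), GR lane, seat GR-1 (`pub-hodgecm-own-real34`), after GR-2's
`Prop311PrintedDarbouxLegAlong` §2 (CM).
-/
import Literature.NumberTheory.GelbartRogawski1991.Prop311PrintedDarbouxLegAlong
import HarnessLib

-- build-lane note (ops-buildfix G11b-3 recipe): dependent telescopes of the dual-pair datum; elaborate sequentially.
set_option Elab.async false

/-!
# [GelbartRogawski1991, Prop. 3.1.1] AS PRINTED from a leg over the Darboux frame, along the section — THE rational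
# splitting and the printed conclusion, for an ARBITRARY quadratic `E/F`

Topic `NumberTheory/GelbartRogawski1991`; namespace `Literature.NumberTheory.GelbartRogawski1991.Prop311`.  Proved theorem
only; nothing of [GelbartRogawski1991] or [Weil1964] is asserted; `Prop311AsPrinted` is untouched.

`Prop311PrintedDarbouxLegAlong` §1 is general-`(F, E, σ)`; its §2 (`…_CM_…`) specialises to CM data
`(L⁺, L, conj, imagUnit L)`.  This file is the general-`(F, E, σ, δ)` form of §2's socket

* **`exists_isRationalSplitting_printed_conclusion_of_darbouxLeg_along`** (K2 §3 along the section): for printed data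
  `(V, Φ, ρ)` over ANY quadratic extension `E/F` (non-trivial automorphism `σ`, `δ ∈ E` with `σ δ = -δ ≠ 0`, `δ² = d`), a
  `Φ`-orthogonal `E`-basis `b` with `Φ(bᵢ, bᵢ) = fᵢ δ`, `φ = Tr Φ` non-degenerate, `T = diag(-2 d fᵢ)` invertible, `ρ`
  unitary irreducible: from ONE leg `φ₁ : Mp_ψ(𝐀ⁿ × 𝐀ⁿ, std)ᶜᵒⁿᵗ →* Mp_𝐀(W)` over the Darboux frame (no continuity) and an
  explicit compatible splitting `s` of the dual-pair line datum `pairLineDatum F E σ hσδ hδ hd f e hT` with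
  `g ↦ φ₁ (relabel (s g))` continuous — THE rational splitting `i` (exists: `exists_isRationalSplitting_of_darbouxLeg`;
  unique: `rationalSplitting_unique'`) together with clauses (1) and (2) of Prop. 3.1.1 verbatim
  (`printed_conclusion_of_darbouxLeg_along`), i.e. the binders `(i, _hi, _hi!)` AND the conclusion of `Prop311AsPrinted`
  at this model.

The CM theorem `exists_isRationalSplitting_printed_conclusion_CM_of_darbouxLeg_along` is the case
`(F, E, σ, δ, hT) = (L⁺, L, conj, imagUnit L, isUnit_det_cmLineGram_of_nondegenerate …)`.  Written for the general-`(F, E, σ)`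
programme (seat GR-1, §D «END modulo the record»).  Nothing in this file is a claim of the manuscripts adjudicated by the
Hodge-CM cell.

## References
* [GelbartRogawski1991] S. Gelbart, J. Rogawski, Invent. Math. 105 (1991) 445–472, §3.1 p. 454 L17–42, L35–36; Prop. 3.1.1
  p. 455 L1–2.
* [Weil1964] A. Weil, Acta Math. 111 (1964) 143–211, Chap. III n° 39–43.
-/

set_option autoImplicit false

noncomputable section

open NumberField
open scoped TensorProduct Matrix Kronecker
open Literature.NumberTheory.Automorphic
open Literature.NumberTheory.Automorphic.UnitaryGroup
open Literature.RepresentationTheory.HeisenbergGroup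
open Literature.NumberTheory.Weil1964

namespace Literature.NumberTheory.GelbartRogawski1991

namespace Prop311

open QuadraticCoordinates UnitaryDualPair

section Quadratic

variable (F : Type) [Field F] [NumberField F]
variable (E : Type) [Field E] [NumberField E] [Algebra F E] [Algebra.IsQuadraticExtension F E]
variable (σ : E ≃ₐ[F] E) {δ : E} (hσδ : σ δ = -δ) (hδ : δ ≠ 0) {d : F} (hd : δ * δ = algebraMap F E d)
variable (V : Type) [AddCommGroup V] [Module F V] [Module E V] [IsScalarTower F E V]
variable {n : ℕ} (b : Module.Basis (Fin n) E V)
variable (Φ : V →ₗ[F] V →ₗ[F] E) (f : Fin n → F)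
variable (e : Fin n × Fin 1 ≃ Fin n) (he : ∀ k : Fin n, (e.symm k).1 = k)
variable {S : Type} [NormedAddCommGroup S] [InnerProductSpace ℂ S] [CompleteSpace S]
variable (ρ : Representation ℂ (AdelicHeisenberg F E V Φ) S)

include he in
/-- **K2 §3 along the section, for an arbitrary quadratic `E/F`**: in a given `Φ`-orthogonal frame, from ONE leg over the
Darboux frame (no continuity) and an explicit compatible splitting of the dual-pair line datum with continuous composite:
THE rational splitting `i` (exists — `exists_isRationalSplitting_of_darbouxLeg`, no continuity used; unique —
`rationalSplitting_unique'`) together with clauses (1) and (2) of Prop. 3.1.1 verbatim, i.e. the binders `(i, _hi, _hi!)`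
AND the conclusion of `Prop311AsPrinted` at this model. [cite: GelbartRogawski1991, §3.1 p. 454 L35–36; Prop. 3.1.1 p. 455 L1–2] -/
theorem exists_isRationalSplitting_printed_conclusion_of_darbouxLeg_along
    (hΦ₁ : ∀ (a : E) (x y : V), Φ (a • x) y = a * Φ x y)
    (hΦ₂ : ∀ (a : E) (x y : V), Φ x (a • y) = Φ x y * σ a)
    (hΦ₃ : ∀ x y : V, Φ y x = -σ (Φ x y))
    (hb : ∀ i j, i ≠ j → Φ (b i) (b j) = 0)
    (hf : ∀ i, Φ (b i) (b i) = algebraMap F E (f i) * δ)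
    (hφ : (traceForm F E V Φ).Nondegenerate)
    (hT : IsUnit (symplecticGram F d f).det)
    (hρu : ∀ (h : AdelicHeisenberg F E V Φ) (v : S), ‖ρ h v‖ = ‖v‖)
    (hρi : ∀ K : Submodule ℂ S, IsClosed (K : Set S) →
      (∀ (h : AdelicHeisenberg F E V Φ), ∀ v ∈ K, ρ h v ∈ K) → K = ⊥ ∨ K = ⊤)
    (φ₁ : adelicMpCont F (Fin n) (1 : Matrix (Fin n) (Fin n) (AdeleRing (𝓞 F) F)) →* adelicMp F E V Φ ρ)
    (hproj₁ : ∀ (m₁ : adelicMpCont F (Fin n) (1 : Matrix (Fin n) (Fin n) (AdeleRing (𝓞 F) F)))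
        (c : (Fin n → AdeleRing (𝓞 F) F) × (Fin n → AdeleRing (𝓞 F) F)),
      ((proj F E V Φ ρ (φ₁ m₁) : adelicSp F E V Φ) : AdelicSpace F V ≃ₗ[AdeleRing (𝓞 F) F] AdelicSpace F V)
          (darbouxFrame F E σ hσδ hδ hd V b f e hT c) =
        darbouxFrame F E σ hσδ hδ hd V b f e hT
          (((adelicMpCont.proj F (Fin n) (1 : Matrix (Fin n) (Fin n) (AdeleRing (𝓞 F) F)) m₁ :
              symplecticGroup (polar (adelicForm F (Fin n) (1 : Matrix (Fin n) (Fin n) (AdeleRing (𝓞 F) F))))) :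
            ((Fin n → AdeleRing (𝓞 F) F) × (Fin n → AdeleRing (𝓞 F) F)) ≃ₗ[AdeleRing (𝓞 F) F]
              ((Fin n → AdeleRing (𝓞 F) F) × (Fin n → AdeleRing (𝓞 F) F))) c))
    (h₀ : ∃ s, (pairLineDatum F E σ hσδ hδ hd f e hT).IsCompatible s ∧
      Continuous fun g => φ₁ (adelicMpContRelabel F (Fin n) (legGL F f e hT) (one_mul_legGL F f e hT) (s g))) :
    ∃ i : ratSp F E V Φ →* adelicMp F E V Φ ρ,
      IsRationalSplitting F E V Φ ρ i ∧
      (∀ i' : ratSp F E V Φ →* adelicMp F E V Φ ρ, IsRationalSplitting F E V Φ ρ i' → i' = i) ∧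
      (∃ s : adelicUnitary F E V Φ →* adelicMp F E V Φ ρ,
          ∀ g : adelicUnitary F E V Φ,
            projEnd F E V Φ ρ (s g) =
              ((g : AdelicSpace F V ≃ₗ[AdeleRing (𝓞 F) F] AdelicSpace F V) :
                AdelicSpace F V →ₗ[AdeleRing (𝓞 F) F] AdelicSpace F V)) ∧
        ∃ s : adelicUnitary F E V Φ →* adelicMp F E V Φ ρ,
          Continuous s ∧
          (∀ g : adelicUnitary F E V Φ,
            projEnd F E V Φ ρ (s g) =
              ((g : AdelicSpace F V ≃ₗ[AdeleRing (𝓞 F) F] AdelicSpace F V) :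
                AdelicSpace F V →ₗ[AdeleRing (𝓞 F) F] AdelicSpace F V)) ∧
          ∀ g : adelicUnitary F E V Φ,
            IsRationalPoint F E V Φ (g : AdelicSpace F V ≃ₗ[AdeleRing (𝓞 F) F] AdelicSpace F V) → s g ∈ i.range := by
  haveI : FiniteDimensional E V := Module.Finite.of_basis b
  have hex := exists_isRationalSplitting_of_darbouxLeg F E σ hσδ hδ hd V b Φ f ρ e he hΦ₁ hΦ₂ hb hf hφ hT φ₁ hproj₁
  obtain ⟨i, hi⟩ := hex
  have hi! : ∀ i' : ratSp F E V Φ →* adelicMp F E V Φ ρ, IsRationalSplitting F E V Φ ρ i' → i' = i := fun i' hi' =>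
    rationalSplitting_unique' F E V Φ ρ σ hΦ₃ hφ hρu hρi i i' hi hi'
  exact ⟨i, hi, hi!, printed_conclusion_of_darbouxLeg_along F E σ hσδ hδ hd V b Φ f e he ρ i hi hΦ₁ hΦ₂ hb hf hφ hi! hT
    φ₁ hproj₁ h₀⟩

end Quadratic

end Prop311

end Literature.NumberTheory.GelbartRogawski1991

end
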